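import Mathlib
import Summits.Ventures.PercRepro.TriangleCapThreeTrianglesG

/-!
# PercRepro — TWO BELOW THE DIAGONAL IS EXACT ON THE `K₄⁻`-FREE CLASS FOR EVERY `k ≥ 10` (p3, gen 37; part 68)

With the one-triangle case (`k ≥ 10`, gen 36), the two-triangle case (`k ≥ 8`, TriangleCapTwoTrianglesEightC/E) and
the three-triangle case (`k ≥ 10`, TriangleCapThreeTrianglesG, four triangles by the envelope from `k = 9`), the
dense-corner stability with gap `2 (k − 3)` holds for every `k ≥ 10`:

* **`dense_stability_two_of_ten`** — `K₄⁻`-free, `k ≥ 10`, `m ≥ 2k − 3`, not bipartite spanning with at most one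
  missing cross pair ⇒ `Σ_v d(v)² + 2 (k − 3) ≤ m k`;
* **`two_below_diagonal_exact_k4m_of_ten`** — for `k ≥ 10` and `m = a(k − a) − 2 ≥ 2k − 3` with `m, m + 1` not of
  the form `a′(k − a′)`, the `K₄⁻`-free cherry maximum IS `(m(k − 2) − 2(k − 3))/2` (gen 36: `k ≥ 20`; part 60:
  `k ≥ 12`);
* the cells `(10, 22) = 81`, `(11, 22) = 91`, `(11, 26) = 109` (`2 · cherries`: `162`, `182`, `218`).
The band of the closed form at `r = 2` on the `K₄⁻`-free class is now `8 ≤ k ≤ 9`: the cells `(8, 13)`, `(9, 16)`.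
Axioms: standard.
-/

namespace PercRepro

namespace TriangleCap

namespace C047

open Finset

variable {V : Type*} [Fintype V] [DecidableEq V]

/-- **TWO BELOW THE DIAGONAL, `K₄⁻`-FREE, `k ≥ 10`:** the dense-corner stability with gap `2 (k − 3)`. -/
theorem dense_stability_two_of_ten (D : SimpleGraph V) [DecidableRel D.Adj] (hK : K4mFree D)
    (hk : 10 ≤ Fintype.card V) (hm : 2 * Fintype.card V ≤ D.edgeFinset.card + 3)
    (hnot : ¬ ∃ A : Finset V, (∀ x y, D.Adj x y → (x ∈ A ↔ y ∉ A)) ∧ (missing D A Aᶜ).card ≤ 1) :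
    ∑ v, deg D v * deg D v + 2 * (Fintype.card V - 3) ≤ D.edgeFinset.card * Fintype.card V := by
  by_cases hfree : D.CliqueFree 3
  · exact triangle_free_stability_two D hfree hm hnot
  · obtain ⟨S, hS⟩ := not_forall.mp hfree
    have hS' := not_not.mp hS
    rw [SimpleGraph.is3Clique_iff] at hS'
    obtain ⟨u, v, w, huv, huw, hvw, -⟩ := hS'
    by_cases hT : ∀ a b c, D.Adj a b → D.Adj a c → D.Adj b c → a = u ∨ a = v ∨ a = w
    · exact one_triangle_stability_two D hK hk huv huw hvw hT hm
    · simp only [not_forall, not_or] at hT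
      obtain ⟨a, b, c, hab, hac, hbc, hau, hav, haw⟩ := hT
      have ha : ¬ (a = u ∨ a = v ∨ a = w) := fun h => by
        rcases h with h | h | h
        · exact hau h
        · exact hav h
        · exact haw h
      by_cases hT3 : ∀ x y z, D.Adj x y → D.Adj x z → D.Adj y z →
          x = u ∨ x = v ∨ x = w ∨ x = a ∨ x = b ∨ x = c
      · exact two_triangles_stability_two_of_eight D hK (by omega) hm huv huw hvw hab hac hbc ha hT3
      · simp only [not_forall, not_or] at hT3
        obtain ⟨x, y, z, hxy, hxz, hyz, hxu, hxv, hxw, hxa, hxb, hxc⟩ := hT3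
        exact three_triangles_stability_two_of_ten D hK hk hm huv huw hvw hab hac hbc hxy hxz hyz ha
          (fun h => by
            rcases h with h | h | h | h | h | h
            · exact hxu h
            · exact hxv h
            · exact hxw h
            · exact hxa h
            · exact hxb h
            · exact hxc h)

/-- **TWO BELOW THE DIAGONAL IS EXACT ON THE `K₄⁻`-FREE CLASS FOR EVERY `k ≥ 10`.** -/
theorem two_below_diagonal_exact_k4m_of_ten (k a : ℕ) (hk : 10 ≤ k) (ha : 1 ≤ a) (hak : a + 2 ≤ k)
    (hdense : 2 * k ≤ a * (k - a) - 2 + 3)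
    (hm : ∀ a', a' ≤ k → a * (k - a) - 2 ≠ a' * (k - a') ∧ a * (k - a) - 1 ≠ a' * (k - a')) :
    (∀ (D : SimpleGraph (Fin k)) [DecidableRel D.Adj], K4mFree D →
        D.edgeFinset.card = a * (k - a) - 2 →
        2 * cherries D + 2 * (k - 3) ≤ (a * (k - a) - 2) * (k - 2)) ∧
      ∃ (D : SimpleGraph (Fin k)) (_ : DecidableRel D.Adj), K4mFree D ∧
        D.edgeFinset.card = a * (k - a) - 2 ∧ 2 * cherries D + 2 * (k - 3) = (a * (k - a) - 2) * (k - 2) := by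
  have hka : 2 ≤ a * (k - a) := by
    obtain ⟨c, hc⟩ : ∃ c, k = a + 2 + c := ⟨k - a - 2, by omega⟩
    subst hc
    have : a + 2 + c - a = 2 + c := by omega
    rw [this]
    nlinarith
  obtain ⟨m, hmm⟩ : ∃ m, a * (k - a) = m + 2 := ⟨a * (k - a) - 2, by omega⟩
  have e1 : a * (k - a) - 2 = m := by omega
  have e2 : a * (k - a) - 1 = m + 1 := by omega
  rw [e1] at hdense hm ⊢
  rw [e2] at hm
  constructor
  · intro D _ hK hD
    have hcard : Fintype.card (Fin k) = k := Fintype.card_fin k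
    have hnot : ¬ ∃ A : Finset (Fin k), (∀ x y, D.Adj x y → (x ∈ A ↔ y ∉ A)) ∧ (missing D A Aᶜ).card ≤ 1 := by
      rintro ⟨A, hA, hN⟩
      have hNX := card_missing_add_card_edges D A hA
      have hXc : Aᶜ.card = k - A.card := by
        have := card_add_card_compl A
        rw [hcard] at this
        omega
      have hXk : A.card ≤ k := by
        have := card_le_univ A
        rwa [hcard] at this
      obtain ⟨h1, h2⟩ := hm A.card hXk
      rw [hXc, hD] at hNX
      have : (missing D A Aᶜ).card = 0 ∨ (missing D A Aᶜ).card = 1 := by omega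
      rcases this with h | h
      · rw [h] at hNX; exact h1 (by omega)
      · rw [h] at hNX; exact h2 (by omega)
    have h1 := dense_stability_two_of_ten D hK (by rw [hcard]; exact hk) (by rw [hcard, hD]; exact hdense) hnot
    have h2 := two_mul_cherries_add D
    have h3 := sum_deg_eq D
    rw [hcard, hD] at h1
    obtain ⟨k', hk'⟩ : ∃ k', k = k' + 3 := ⟨k - 3, by omega⟩
    subst hk'
    have e3 : k' + 3 - 3 = k' := by omega
    have e4 : k' + 3 - 2 = k' + 1 := by omega
    rw [e3] at h1 ⊢
    rw [e4]
    rw [hD] at h3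
    nlinarith
  · refine ⟨bipMinusStar k a 2, inferInstance, k4mFree_bipMinusStar k a 2, ?_, ?_⟩
    · have := card_edges_bipMinusStar k a 2 ha hak
      omega
    · have h := two_mul_cherries_bipMinusStar k a 2 ha hak (by omega)
      rw [hmm] at h
      obtain ⟨k', hk'⟩ : ∃ k', k = k' + 3 := ⟨k - 3, by omega⟩
      subst hk'
      have e3 : k' + 3 - 3 = k' := by omega
      have e4 : k' + 3 - 2 = k' + 1 := by omega
      have e5 : 2 * (k' + 3) - 2 - 3 = 2 * k' + 1 := by omega
      rw [e4, e5] at h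
      rw [e3, e4]
      nlinarith

/-- The cell `(10, 22)` on `K₄⁻`-free graphs (`22 = 4·6 − 2`; `22, 23` are not products `a′(10 − a′)`):
`2·cherries ≤ 162`, attained. -/
theorem cell_ten_twentytwo_k4m :
    (∀ (D : SimpleGraph (Fin 10)) [DecidableRel D.Adj], K4mFree D → D.edgeFinset.card = 22 →
      2 * cherries D ≤ 162) ∧
    ∃ (D : SimpleGraph (Fin 10)) (_ : DecidableRel D.Adj), K4mFree D ∧ D.edgeFinset.card = 22 ∧
      2 * cherries D = 162 := by
  have h := two_below_diagonal_exact_k4m_of_ten 10 4 (by norm_num) (by norm_num) (by norm_num) (by norm_num)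
    (by decide)
  have e1 : 4 * (10 - 4) - 2 = 22 := by norm_num
  have e2 : (4 * (10 - 4) - 2) * (10 - 2) = 176 := by norm_num
  have e3 : 2 * (10 - 3) = 14 := by norm_num
  rw [e1, e2, e3] at h
  obtain ⟨h1, D, inst, h2, h3, h4⟩ := h
  exact ⟨fun D _ hK hD => by have := h1 D hK hD; omega, D, inst, h2, h3, by omega⟩

/-- The cell `(11, 22)` on `K₄⁻`-free graphs (`22 = 3·8 − 2`; `22, 23` are not products `a′(11 − a′)`):
`2·cherries ≤ 182`, attained. -/
theorem cell_eleven_twentytwo_k4m :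
    (∀ (D : SimpleGraph (Fin 11)) [DecidableRel D.Adj], K4mFree D → D.edgeFinset.card = 22 →
      2 * cherries D ≤ 182) ∧
    ∃ (D : SimpleGraph (Fin 11)) (_ : DecidableRel D.Adj), K4mFree D ∧ D.edgeFinset.card = 22 ∧
      2 * cherries D = 182 := by
  have h := two_below_diagonal_exact_k4m_of_ten 11 3 (by norm_num) (by norm_num) (by norm_num) (by norm_num)
    (by decide)
  have e1 : 3 * (11 - 3) - 2 = 22 := by norm_num
  have e2 : (3 * (11 - 3) - 2) * (11 - 2) = 198 := by norm_num
  have e3 : 2 * (11 - 3) = 16 := by norm_num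
  rw [e1, e2, e3] at h
  obtain ⟨h1, D, inst, h2, h3, h4⟩ := h
  exact ⟨fun D _ hK hD => by have := h1 D hK hD; omega, D, inst, h2, h3, by omega⟩

/-- The cell `(11, 26)` on `K₄⁻`-free graphs (`26 = 4·7 − 2`; `26, 27` are not products `a′(11 − a′)`):
`2·cherries ≤ 218`, attained. -/
theorem cell_eleven_twentysix_k4m :
    (∀ (D : SimpleGraph (Fin 11)) [DecidableRel D.Adj], K4mFree D → D.edgeFinset.card = 26 →
      2 * cherries D ≤ 218) ∧
    ∃ (D : SimpleGraph (Fin 11)) (_ : DecidableRel D.Adj), K4mFree D ∧ D.edgeFinset.card = 26 ∧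
      2 * cherries D = 218 := by
  have h := two_below_diagonal_exact_k4m_of_ten 11 4 (by norm_num) (by norm_num) (by norm_num) (by norm_num)
    (by decide)
  have e1 : 4 * (11 - 4) - 2 = 26 := by norm_num
  have e2 : (4 * (11 - 4) - 2) * (11 - 2) = 234 := by norm_num
  have e3 : 2 * (11 - 3) = 16 := by norm_num
  rw [e1, e2, e3] at h
  obtain ⟨h1, D, inst, h2, h3, h4⟩ := h
  exact ⟨fun D _ hK hD => by have := h1 D hK hD; omega, D, inst, h2, h3, by omega⟩

end C047

end TriangleCap

end PercRepro
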